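import Mathlib.Analysis.SpecialFunctions.Complex.CircleAddChar
import Mathlib.NumberTheory.LegendreSymbol.AddCharacter
import Mathlib.Data.ZMod.Units
import Literature.NumberTheory.LFunctions.KloostermanPrimePower
import HarnessLib

/-!
# Quadratic Gauss sums `G(a, k; c) = ∑_{r mod c} e((a r² + k r)/c)` for the theta multiplier

Support file for the transformation law of Shimura's theta function `θ(z) = ∑ e^{2πi n² z}`
under `SL₂(ℤ)` (`HalfIntegralWeightThetaTransformation`): Poisson summation expresses `θ(γz)`,
`γ = (a b; c d)`, `c > 0`, through the generalized quadratic Gauss sums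
`G(a, k; c) = ∑_{r mod c} e((a r² + k r)/c)` (`e(x) = exp(2πix)`), and for `γ ∈ Γ₀(4)` the sum
collapses to `G(a; c) θ(z)` with `G(a; c) = G(a, 0; c)` (Shimura 1973, §1; Koblitz GTM 97, III §3–4
and IV §1; Iwaniec, *Topics in classical automorphic forms*, §10). This file is the finite,
purely algebraic part:

* `quadGaussSum c a k = G(a, k; c)` for `a k : ZMod c` (Mathlib's additive character
  `ZMod.stdAddChar j = e(j/c)`); `quadGaussSum_eq_sum_range` (the sum over `0 ≤ r < c` of
  explicit exponentials); `norm_quadGaussSum_le` (`|G| ≤ c`).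
* `quadGaussSum_eq_zero_of_odd` — for `4 ∣ c` and `k` odd, `G(a, k; c) = 0` (shift `r ↦ r + c/2`).
* `stdAddChar_mul_quadGaussSum_two_mul` — completing the square: if `a d = 1` in `ℤ/c` then
  `e(d l²/c) G(a, 2l; c) = G(a; c)`.
* `quadGaussSum_eq_zero_of_mod_four_eq_two` — for `c ≡ 2 (mod 4)`, `a` odd and `k` even,
  `G(a, k; c) = 0`.
* `quadGaussSum_unit_sq_mul` — `G(u² a; c) = G(a; c)` for a unit `u`; in particular
  `G(4a; c) = G(a; c)` for odd `c` (`quadGaussSum_four_mul_left`).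
* `quadGaussSum_four_mul` — `G(a; 4m) = 2 G(a; m)` for `4 ∣ m` and `a` odd (the relation behind
  `θ(4γz)/θ(4z) = θ(γz)/θ(z)` on `Γ₀(16)`).

Nothing here evaluates the sign of a Gauss sum; the values at odd prime powers and powers of `2`
are in the sequel files. Mathlib has Gauss sums of multiplicative characters (`gaussSum`) but not
these quadratic exponential sums to composite moduli.

## References

* G. Shimura, *On modular forms of half integral weight*, Ann. of Math. 97 (1973) 440–481, §1.
* N. Koblitz, *Introduction to Elliptic Curves and Modular Forms*, GTM 97, 2nd ed. (1993),
  Ch. III §3 (theta transformation), Ch. IV §1.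
* H. Iwaniec, *Topics in Classical Automorphic Forms*, AMS GSM 17 (1997), §10.
-/

noncomputable section

open Complex Finset

namespace Literature.NumberTheory.EllipticCurves.ModularForms

open Literature.NumberTheory.LFunctions (sum_zmod_eq_sum_range sum_range_mul_eq_sum_sum
  stdAddChar_natCast norm_stdAddChar)

variable {c : ℕ} [NeZero c]

/-- **The generalized quadratic Gauss sum** `G(a, k; c) = ∑_{r mod c} e((a r² + k r)/c)`,
`e(x) = exp(2πix)`, for residues `a, k` modulo `c ≥ 1`. [folklore] -/
def quadGaussSum (c : ℕ) [NeZero c] (a k : ZMod c) : ℂ :=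
  ∑ r : ZMod c, (ZMod.stdAddChar (a * r ^ 2 + k * r) : ℂ)

/-- Unfolding `quadGaussSum`. [folklore] -/
theorem quadGaussSum_def (a k : ZMod c) :
    quadGaussSum c a k = ∑ r : ZMod c, (ZMod.stdAddChar (a * r ^ 2 + k * r) : ℂ) := rfl

/-- `G(a, k; c)` as the sum over the representatives `0 ≤ r < c` of explicit exponentials:
`G(a, k; c) = ∑_{r < c} exp(2πi (a r² + k r)/c)`. [folklore] -/
theorem quadGaussSum_eq_sum_range (a k : ℤ) :
    quadGaussSum c a k =
      ∑ r ∈ range c, cexp (2 * Real.pi * I * ((a * r ^ 2 + k * r : ℤ) : ℂ) / c) := by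
  rw [quadGaussSum_def, sum_zmod_eq_sum_range]
  refine sum_congr rfl fun r _ ↦ ?_
  have : ((a : ZMod c) * (r : ZMod c) ^ 2 + (k : ZMod c) * (r : ZMod c)) =
      ((a * r ^ 2 + k * r : ℤ) : ZMod c) := by push_cast; ring
  rw [this, ZMod.stdAddChar_coe]

/-- The trivial bound `|G(a, k; c)| ≤ c`. [folklore] -/
theorem norm_quadGaussSum_le (a k : ZMod c) : ‖quadGaussSum c a k‖ ≤ c := by
  rw [quadGaussSum_def]
  calc ‖∑ r : ZMod c, (ZMod.stdAddChar (a * r ^ 2 + k * r) : ℂ)‖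
      ≤ ∑ r : ZMod c, ‖(ZMod.stdAddChar (a * r ^ 2 + k * r) : ℂ)‖ := norm_sum_le _ _
    _ = c := by simp [ZMod.card]

/-- Translating the summation variable: `∑_r e(f(r + h)) = ∑_r e(f(r))`-type reindexing for
`G(a, k; c)`: `G(a, k; c) = ∑_r e((a (r + h)² + k (r + h))/c)`. [folklore] -/
theorem quadGaussSum_eq_sum_add (a k h : ZMod c) :
    quadGaussSum c a k = ∑ r : ZMod c, (ZMod.stdAddChar (a * (r + h) ^ 2 + k * (r + h)) : ℂ) := by
  rw [quadGaussSum_def]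
  exact (Fintype.sum_equiv (Equiv.addRight h) _ _ fun r ↦ rfl).symm

/-- `e((c/2)/c) = -1` for even `c`. [folklore] -/
theorem stdAddChar_half (hc : 2 ∣ c) :
    (ZMod.stdAddChar (((c / 2 : ℕ) : ZMod c)) : ℂ) = -1 := by
  rw [stdAddChar_natCast]
  have hc0 : (c : ℂ) ≠ 0 := Nat.cast_ne_zero.mpr (NeZero.ne c)
  have h2 : ((c / 2 : ℕ) : ℂ) = (c : ℂ) / 2 := by
    rw [eq_div_iff two_ne_zero]; exact_mod_cast Nat.div_mul_cancel hc
  rw [h2, show 2 * (Real.pi : ℂ) * I * (c / 2) / c = Real.pi * I by field_simp]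
  exact exp_pi_mul_I

omit [NeZero c] in
/-- In `ℤ/c` with `c` even, `2 · (c/2) = 0`. [folklore] -/
theorem two_mul_half (hc : 2 ∣ c) : (2 : ZMod c) * ((c / 2 : ℕ) : ZMod c) = 0 := by
  have : ((2 * (c / 2) : ℕ) : ZMod c) = 0 := by
    rw [Nat.mul_div_cancel' hc]; exact ZMod.natCast_self c
  exact_mod_cast this

/-- In `ℤ/c` with `4 ∣ c`, `(c/2)² = 0` (as `(c/2)² = c · (c/4)`). [folklore] -/
theorem half_sq_of_four_dvd (hc : 4 ∣ c) : ((c / 2 : ℕ) : ZMod c) ^ 2 = 0 := by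
  obtain ⟨m, rfl⟩ := hc
  have h1 : 4 * m / 2 = 2 * m := by omega
  have : (((4 * m / 2) ^ 2 : ℕ) : ZMod (4 * m)) = 0 := by
    rw [h1, show (2 * m) ^ 2 = (4 * m) * m by ring, Nat.cast_mul, ZMod.natCast_self, zero_mul]
  exact_mod_cast this

/-- **`G(a, k; c) = 0` for `4 ∣ c` and `k` odd**: the shift `r ↦ r + c/2` changes the phase
`a r² + k r` by `c/2` modulo `c`, i.e. multiplies every term by `e(1/2) = -1`. [folklore] -/
theorem quadGaussSum_eq_zero_of_odd (hc : 4 ∣ c) (a : ZMod c) {k : ℤ} (hk : Odd k) :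
    quadGaussSum c a k = 0 := by
  set h : ZMod c := ((c / 2 : ℕ) : ZMod c) with hh
  have h2 : 2 ∣ c := dvd_trans (by norm_num) hc
  have hkh : (k : ZMod c) * h = h := by
    obtain ⟨j, rfl⟩ := hk
    push_cast
    linear_combination (j : ZMod c) * two_mul_half h2
  have hsq : h ^ 2 = 0 := half_sq_of_four_dvd hc
  have key : quadGaussSum c a k = -quadGaussSum c a k := by
    conv_lhs => rw [quadGaussSum_eq_sum_add a k h]
    rw [quadGaussSum_def, ← neg_one_mul, Finset.mul_sum]
    refine sum_congr rfl fun r _ ↦ ?_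
    have : a * (r + h) ^ 2 + (k : ZMod c) * (r + h) = (a * r ^ 2 + (k : ZMod c) * r) + h := by
      linear_combination a * hsq + (a * r) * two_mul_half h2 + hkh
    rw [this, AddChar.map_add_eq_mul, stdAddChar_half h2]
    ring
  have : (2 : ℂ) * quadGaussSum c a k = 0 := by linear_combination key
  simpa using this

/-- **Completing the square**: if `a d = 1` in `ℤ/c` then `e(d l²/c) G(a, 2l; c) = G(a; c)`
(substitute `r ↦ r - d l`: `a (r - dl)² + 2l (r - dl) = a r² - d l²`). [folklore] -/
theorem stdAddChar_mul_quadGaussSum_two_mul (a d l : ZMod c) (had : a * d = 1) :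
    (ZMod.stdAddChar (d * l ^ 2) : ℂ) * quadGaussSum c a (2 * l) = quadGaussSum c a 0 := by
  rw [quadGaussSum_eq_sum_add a (2 * l) (-(d * l)), quadGaussSum_def, Finset.mul_sum]
  refine sum_congr rfl fun r _ ↦ ?_
  have : a * (r + -(d * l)) ^ 2 + 2 * l * (r + -(d * l)) = -(d * l ^ 2) + (a * r ^ 2 + 0 * r) := by
    linear_combination (d * l ^ 2 - 2 * l * r) * had
  rw [this, AddChar.map_add_eq_mul, ← mul_assoc, ← AddChar.map_add_eq_mul, add_neg_cancel,
    AddChar.map_zero_eq_one, one_mul]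

omit [NeZero c] in
/-- In `ℤ/c` with `c ≡ 2 (mod 4)`, `(c/2)² = c/2` (`n² ≡ n (mod 2n)` for odd `n = c/2`). [folklore] -/
theorem half_sq_of_mod_four_eq_two (hc : c % 4 = 2) :
    ((c / 2 : ℕ) : ZMod c) ^ 2 = ((c / 2 : ℕ) : ZMod c) := by
  obtain ⟨n, hn⟩ : ∃ n, c = 2 * (2 * n + 1) := ⟨c / 4, by omega⟩
  have h1 : c / 2 = 2 * n + 1 := by omega
  have : (((c / 2) ^ 2 : ℕ) : ZMod c) = ((c / 2 + c * n : ℕ) : ZMod c) := by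
    congr 1; rw [h1, hn]; ring
  rw [Nat.cast_pow] at this
  rw [this]; push_cast; rw [ZMod.natCast_self]; ring

/-- **`G(a, k; c) = 0` for `c ≡ 2 (mod 4)`, `a` odd and `k` even**: the shift `r ↦ r + c/2`
changes `a r² + k r` by `a (c/2)² + k (c/2) ≡ c/2 (mod c)`. In particular `G(a; c) = 0` for such
`c` and `a` coprime to `c`. [folklore] -/
theorem quadGaussSum_eq_zero_of_mod_four_eq_two (hc : c % 4 = 2) {a k : ℤ} (ha : Odd a)
    (hk : Even k) : quadGaussSum c a k = 0 := by
  set h : ZMod c := ((c / 2 : ℕ) : ZMod c) with hh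
  have h2 : 2 ∣ c := by omega
  have hkh : (k : ZMod c) * h = 0 := by
    obtain ⟨j, rfl⟩ := hk
    push_cast
    linear_combination (j : ZMod c) * two_mul_half h2
  have hah : (a : ZMod c) * h ^ 2 = h := by
    obtain ⟨j, rfl⟩ := ha
    rw [half_sq_of_mod_four_eq_two hc]
    push_cast
    linear_combination (j : ZMod c) * two_mul_half h2
  have key : quadGaussSum c a k = -quadGaussSum c a k := by
    conv_lhs => rw [quadGaussSum_eq_sum_add a k h]
    rw [quadGaussSum_def, ← neg_one_mul, Finset.mul_sum]
    refine sum_congr rfl fun r _ ↦ ?_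
    have : (a : ZMod c) * (r + h) ^ 2 + (k : ZMod c) * (r + h) =
        ((a : ZMod c) * r ^ 2 + (k : ZMod c) * r) + h := by
      linear_combination hah + ((a : ZMod c) * r) * two_mul_half h2 + hkh
    rw [this, AddChar.map_add_eq_mul, stdAddChar_half h2]
    ring
  have : (2 : ℂ) * quadGaussSum c a k = 0 := by linear_combination key
  simpa using this

/-- **`G(u² a; c) = G(a; c)` for a unit `u` modulo `c`** (substitute `r ↦ u r`). [folklore] -/
theorem quadGaussSum_unit_sq_mul {u : ZMod c} (hu : IsUnit u) (a : ZMod c) :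
    quadGaussSum c (u ^ 2 * a) 0 = quadGaussSum c a 0 := by
  rw [quadGaussSum_def, quadGaussSum_def]
  refine Fintype.sum_equiv (hu.unit.mulLeft) _ _ fun r ↦ ?_
  simp only [zero_mul, add_zero, Units.mulLeft_apply, IsUnit.unit_spec]
  ring_nf

/-- **`G(4a; c) = G(a; c)` for odd `c`** (`2` is a unit modulo `c`). [folklore] -/
theorem quadGaussSum_four_mul_left (hc : Odd c) (a : ZMod c) :
    quadGaussSum c (4 * a) 0 = quadGaussSum c a 0 := by
  have h2 : IsUnit (2 : ZMod c) := by
    have : ((2 : ℕ) : ZMod c) = 2 := by norm_cast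
    rw [← this, ZMod.isUnit_iff_coprime]
    exact Nat.coprime_two_left.mpr hc
  simpa [show (2 : ZMod c) ^ 2 * a = 4 * a by ring] using quadGaussSum_unit_sq_mul h2 a

/-! ### `G(a; 4m) = 2 G(a; m)` for `4 ∣ m` -/

/-- `exp A = exp B` when `A - B ∈ 2πi ℤ`. [folklore] -/
theorem cexp_eq_cexp_of_sub_eq {A B : ℂ} (n : ℤ) (h : A - B = 2 * Real.pi * I * n) :
    cexp A = cexp B := by
  have : A = B + n * (2 * Real.pi * I) := by linear_combination h
  rw [this, Complex.exp_add, Complex.exp_int_mul_two_pi_mul_I, mul_one]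

/-- `∑_{u < 2k} F(u) = ∑_{v < k} (F(2v) + F(2v + 1))`. [folklore] -/
theorem sum_range_even_add_odd {M : Type*} [AddCommMonoid M] (k : ℕ) (F : ℕ → M) :
    ∑ u ∈ range (2 * k), F u = ∑ v ∈ range k, (F (2 * v) + F (2 * v + 1)) := by
  rw [sum_range_mul_eq_sum_sum, Finset.sum_comm]
  refine sum_congr rfl fun v _ ↦ ?_
  rw [Finset.sum_range_succ, Finset.sum_range_one]
  congr 1 <;> congr 1 <;> ring

/-- The terms `e(a r²/m)` of `G(a; m)`, as a function of `r ∈ ℕ`. [folklore] -/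
theorem quadGaussSum_zero_eq_sum_range (m : ℕ) [NeZero m] (a : ℤ) :
    quadGaussSum m a 0 = ∑ r ∈ range m, cexp (2 * Real.pi * I * ((a * r ^ 2 : ℤ) : ℂ) / m) := by
  rw [show ((0 : ZMod m)) = ((0 : ℤ) : ZMod m) by simp, quadGaussSum_eq_sum_range]
  simp only [zero_mul, add_zero]

/-- For `4 ∣ m`, the terms of `G(a; m)` are `m/2`-periodic:
`e(a (r + (m/2) j)²/m) = e(a r²/m) e(a r j + a (m/4) j²) = e(a r²/m)`. [folklore] -/
theorem cexp_sq_add_half (m : ℕ) [NeZero m] (hm4 : 4 ∣ m) (a : ℤ) (r j : ℕ) :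
    cexp (2 * Real.pi * I * ((a * (r + (m / 2) * j : ℕ) ^ 2 : ℤ) : ℂ) / m) =
      cexp (2 * Real.pi * I * ((a * r ^ 2 : ℤ) : ℂ) / m) := by
  obtain ⟨n, rfl⟩ := hm4
  have hn0 : (n : ℂ) ≠ 0 := by
    have : (4 * n : ℕ) ≠ 0 := NeZero.ne (4 * n)
    exact_mod_cast (by omega : n ≠ 0)
  have h2 : 4 * n / 2 = 2 * n := by omega
  rw [h2]
  refine cexp_eq_cexp_of_sub_eq (a * (r * j + n * j ^ 2)) ?_
  push_cast
  field_simp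
  ring

/-- **`G(a; 4m) = 2 G(a; m)` for `4 ∣ m` and `a` odd.** Writing `n = u + m v` (`u < m`, `v < 4`),
`e(a n²/(4m)) = e(a u²/(4m)) (-1)^{u v}` (as `a` is odd and `e(a m v²/4) = 1`), and
`∑_{v<4} (-1)^{uv}` is `4` for `u` even, `0` for `u` odd; for `u = 2t`, `e(a u²/(4m)) = e(a t²/m)`,
`t < m/2`, and the terms of `G(a; m)` are `m/2`-periodic, so `G(a; m) = 2 ∑_{t < m/2} e(a t²/m)`.
This is the Gauss-sum identity behind `θ(4γz) θ(z) = θ(γz) θ(4z)` for `γ ∈ Γ₀(16)`. [folklore] -/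
theorem quadGaussSum_four_mul (m : ℕ) [NeZero m] [NeZero (4 * m)] (hm4 : 4 ∣ m) {a : ℤ}
    (ha : Odd a) : quadGaussSum (4 * m) a 0 = 2 * quadGaussSum m a 0 := by
  obtain ⟨n, hn⟩ := id hm4
  have hm0 : (m : ℂ) ≠ 0 := Nat.cast_ne_zero.mpr (NeZero.ne m)
  have hn0 : (n : ℂ) ≠ 0 := by
    have := NeZero.ne m
    exact_mod_cast (show n ≠ 0 by omega)
  -- Step 1: `G(a; m) = 2 ∑_{t < m/2} e(a t²/m)`.
  have hG : quadGaussSum m a 0 =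
      2 * ∑ t ∈ range (m / 2), cexp (2 * Real.pi * I * ((a * t ^ 2 : ℤ) : ℂ) / m) := by
    rw [quadGaussSum_zero_eq_sum_range]
    have hr : range m = range ((m / 2) * 2) := by congr 1; omega
    rw [hr, sum_range_mul_eq_sum_sum, Finset.mul_sum]
    refine sum_congr rfl fun t _ ↦ ?_
    rw [Finset.sum_range_succ, Finset.sum_range_one, cexp_sq_add_half m hm4 a t 0,
      cexp_sq_add_half m hm4 a t 1, ← two_mul]
  -- Step 2: the sign `e(a u v/2) = (-1)^{uv}` for odd `a`.
  have hsign : ∀ u v : ℕ,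
      cexp (2 * Real.pi * I * (((a * u * v : ℤ) : ℂ) / 2)) = (-1 : ℂ) ^ (u * v) := by
    intro u v
    obtain ⟨j, rfl⟩ := ha
    have : 2 * (Real.pi : ℂ) * I * ((((2 * j + 1) * u * v : ℤ) : ℂ) / 2) =
        (j * u * v : ℤ) * (2 * Real.pi * I) + (u * v : ℕ) * (Real.pi * I) := by
      push_cast; ring
    rw [this, Complex.exp_add, Complex.exp_int_mul_two_pi_mul_I, one_mul, Complex.exp_nat_mul,
      Complex.exp_pi_mul_I]
  -- Step 3: the sum over `n < 4m`, `n = u + m v`.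
  have hL : quadGaussSum (4 * m) a 0 =
      ∑ u ∈ range m, cexp (2 * Real.pi * I * ((a * u ^ 2 : ℤ) : ℂ) / (4 * m : ℕ)) *
        ∑ v ∈ range 4, (-1 : ℂ) ^ (u * v) := by
    rw [quadGaussSum_zero_eq_sum_range]
    have hr : range (4 * m) = range (m * 4) := by rw [mul_comm]
    rw [hr, sum_range_mul_eq_sum_sum]
    refine sum_congr rfl fun u _ ↦ ?_
    rw [Finset.mul_sum]
    refine sum_congr rfl fun v _ ↦ ?_
    rw [← hsign u v, ← Complex.exp_add]
    have h4m : ((4 * m : ℕ) : ℂ) ≠ 0 := by exact_mod_cast (NeZero.ne (4 * m))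
    refine cexp_eq_cexp_of_sub_eq (a * n * v ^ 2) ?_
    rw [hn]; push_cast; field_simp; ring
  -- Step 4: `∑_{v<4} (-1)^{u v} = 4 [u even]`.
  have hS : ∀ u : ℕ, ∑ v ∈ range 4, (-1 : ℂ) ^ (u * v) = if Even u then 4 else 0 := by
    intro u
    split_ifs with hu
    · simp only [pow_mul, hu.neg_one_pow, one_pow, Finset.sum_const, Finset.card_range]
      norm_num
    · simp only [pow_mul, (Nat.not_even_iff_odd.mp hu).neg_one_pow, Finset.sum_range_succ,
        Finset.sum_range_zero]
      norm_num
  rw [hL, hG]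
  simp_rw [hS]
  -- Step 5: keep the even `u = 2t`, `t < m/2`.
  have hr : range m = range (2 * (m / 2)) := by congr 1; omega
  rw [hr, sum_range_even_add_odd, ← mul_assoc, show (2 : ℂ) * 2 = 4 by norm_num, Finset.mul_sum]
  refine sum_congr rfl fun t _ ↦ ?_
  have he : Even (2 * t) := even_two_mul t
  have ho : ¬ Even (2 * t + 1) := Nat.not_even_iff_odd.mpr (odd_two_mul_add_one t)
  rw [if_pos he, if_neg ho, mul_zero, add_zero, mul_comm]
  congr 1
  have h4m : ((4 * m : ℕ) : ℂ) ≠ 0 := by exact_mod_cast (NeZero.ne (4 * m))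
  refine cexp_eq_cexp_of_sub_eq 0 ?_
  push_cast; field_simp; ring

end Literature.NumberTheory.EllipticCurves.ModularForms
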